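import Literature.NumberTheory.GaloisRepresentations.HochschildSerreLowDegree
import Literature.NumberTheory.GaloisRepresentations.ContinuousCupProductCompat
import Literature.NumberTheory.GaloisRepresentations.LocalFieldCdTwo
import Summits.BirchSwinnertonDyer.Rank1Residual.Additive.UnramifiedKummerDisjoint
import HarnessLib

/-!
# Unramified classes of ARBITRARY (ramified) modules are ISOTROPIC for every cup product over a
# non-archimedean local field (cell `b2b-bsdres`, team n1011, row T-2LL "two Lagrangian lines",
# FILE 1; seat p04 GEN 11; skeleton `cells/n1011/skel/T-2LL.md`)

HONEST FRAMING (cell `b2b-bsdres`, run/shared/lean/b2b/bsd-rank1-residual/, verbatim in every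
file): the goal of the cell is to DELETE the COMBINATION-SHAPED residual classes of the
Birch–Swinnerton-Dyer formula for ALL analytic-rank `≤ 1` elliptic curves over `ℚ` — "full BSD
formula for every rank `≤ 1` curve in class `C`" assembled STRICTLY from published theorems — so
that the rank-`≤ 1` remainder becomes exactly the CONSTRUCTION-SHAPED classes, which are TYPED
(missing-input `Prop`s), NOT attempted. This is not "finishing BSD". Team n1011 (N10 / N11, the
additive block X4 ∧ `p = 3`): research route on the CONSTRUCTION-SHAPED class X4; no claim beyond
the stated classes; nothing is booked; no mark / label / count is changed by this file. Theorems
only (no definition, no named fact, no `sorry`); TOOL theorems of continuous group cohomology,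
cell-independent; they close nothing by themselves.

## What

For a topological group `G`, a normal subgroup `N` and discrete `G`-modules `X`, `Y`, `Z` with a
continuous equivariant pairing `⟨ , ⟩ : X × Y → Z` (`ContPairing`, the datum of the tree's cup product
`∪ : H¹(G, X) × H¹(G, Y) → H²(G, Z)`, `ContinuousCupProduct.lean`):

* `cupProduct_infOne_infOne_eq_zero` — **the cup product of two INFLATED classes is inflated**: for
  `x ∈ H¹(G/N, X^N)`, `y ∈ H¹(G/N, Y^N)` (inflation `infOne`, `HochschildSerreLowDegree.lean`),
  `inf x ∪ inf y = inf (x ∪_N y)` for the induced pairing `X^N × Y^N → Z^N` of `G/N`-modules, at the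
  level of the explicit cocycles `(σ, τ) ↦ ⟨f σ, σ g τ⟩` (`ContPairing.cupCocycle`,
  `map_oneCocycleClass`, `map_twoCocycleClass`); hence `inf x ∪ inf y = 0` whenever
  `H²(G/N, Z^N) = 0`. The induced pairing is written as a term inside the proof (no definition).
* `cupProduct_eq_zero_of_mem_unramifiedSubgroup` — **over a non-archimedean local field `F`,
  unramified classes are isotropic**: for discrete `Γ_F`-modules `A`, `B`, `C` with `C` finite and
  `a ∈ H¹_ur(F, A)`, `b ∈ H¹_ur(F, B)` (`DiscreteGaloisModule.unramifiedSubgroup`, the kernel of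
  restriction to `F^nr`), `a ∪ b = 0` in `H²(F, C)`. Indeed `H¹_ur = inf H¹(Γ_F/I_F, (·)^{I_F})`
  (the cell's `Additive.mem_unramifiedSubgroup_one_iff_mem_range_infOne`, inflation–restriction) and
  `H²(Γ_F/I_F, C^{I_F}) = 0` for finite `C` — `cd(Ẑ) ≤ 1`, the tree's
  `subsingleton_two_quotient_galUnr_of_finite` (`LocalFieldCdTwo.lean`). This is the elementary
  half ("`⊆`") of Milne, *ADT*, I Prop. 2.6 / proof of Thm. 2.6: `H¹_ur(M)` and `H¹_ur(M^D)`
  annihilate each other under the local Tate pairing — here for an ARBITRARY pairing and with NO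
  hypothesis on the inertia action (ramified modules allowed).
* `cupProduct_restrict_eq_zero_of_mem_unramifiedSubgroup` — the same for modules over a field `K`
  read over a `K`-field `F` which is a local field (a completion `K_v`), i.e. for the restricted
  pairing `P.restrict (absGaloisRestrict K F)`: the shape of the local Weil cup product
  `H¹(K_v, E[n]) × H¹(K_v, E[n]) → H²(K_v, μₙ)` of `LocalWeilPairingDuality.lean`.

Prior art in the tree (same seat, row T-UO-K, GEN 6): `GaloisImage/UnramifiedCupProductVanishing.lean`
(`UnramifiedCup.cupClass_eq_zero_of_vanishing_of_subsingleton`: COCYCLES vanishing on `N`) and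
`GaloisImage/UnramifiedLocalPairingVanishing.lean` (the local Tate pairing `M × M^D` for a module
`M` UNRAMIFIED at `v`, hypothesis `hI`). The present file is the CLASS-level statement for
ARBITRARY discrete modules — the consumer's module `E[p]` at an ADDITIVE place is ramified — through
inflation (`infOne`) rather than through representatives vanishing on `N`; nothing there is restated.

Consumer (FILE 2 of the row): at a place `w ∤ p` where two `p`-congruent curves both have one
rational line of `p`-torsion, `H¹(K_w, E[p])` is a hyperbolic PLANE for the Weil cup product, its
unramified line is isotropic by this file, and "two Lagrangian lines" forces the local Kummer
conditions of the two curves to coincide.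

## References

* [MilneADT2006] J. S. Milne, *Arithmetic Duality Theorems*, 2nd ed. (2006), Ch. I §2
  (Prop. 2.6 and the proof of Thm. 2.6: unramified cohomology, `H²(Ẑ, ·) = 0` on finite modules).
* [NeukirchSchmidtWingberg2008] J. Neukirch, A. Schmidt, K. Wingberg, *Cohomology of Number
  Fields*, 2nd ed. (2008), I §4 (1.4.2)–(1.4.4), Prop. 1.5.3 (cup product and inflation).
* [SerreGaloisCohomology1997] J.-P. Serre, *Galois Cohomology* (1997), I §2.6 (b), II §5.

## Design

`noncomputable section`; universe `u` shared by the group and the modules (Mathlib's continuous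
cohomology); no local instances: the statements over a local field `F` take
`[LocallyCompactSpace Γ_F]` as an instance hypothesis (consumers have it from the tree's
`absoluteGaloisGroup_compactSpace`, used here only INSIDE the proof, for `Γ_F ⧸ I_F`). Axioms:
`propext`, `Classical.choice`, `Quot.sound`.
-/

noncomputable section

open scoped Classical ContRepresentation
open CategoryTheory Function

universe u

namespace Summit.BirchSwinnertonDyer.Rank1Residual.GaloisImage

namespace TwoLagrangianLines

open Literature.NumberTheory.GaloisRepresentations
open _root_.TopRep _root_.ContRepresentation _root_.ContinuousCohomology

/-! ## §1 Abstract: the cup product of two inflated classes is inflated, hence dies with `H²(G/N, –)` -/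

section Abstract

variable {G : Type u} [Group G] [TopologicalSpace G] [IsTopologicalGroup G] [LocallyCompactSpace G]
  (N : Subgroup G) [N.Normal] [LocallyCompactSpace (G ⧸ N)]
variable {VX VY VZ : Type u}
  [AddCommGroup VX] [TopologicalSpace VX] [DiscreteTopology VX]
  [AddCommGroup VY] [TopologicalSpace VY] [DiscreteTopology VY]
  [AddCommGroup VZ] [TopologicalSpace VZ] [DiscreteTopology VZ]
  {ρX : ContinuousRep G ℤ VX} {ρY : ContinuousRep G ℤ VY} {ρZ : ContinuousRep G ℤ VZ}
  (P : ContPairing ρX.toTopRep ρY.toTopRep ρZ.toTopRep)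

/-- **The cup product of two inflated classes is inflated, hence vanishes with `H²(G/N, Z^N)`.**
For a normal subgroup `N ⊴ G`, discrete `G`-modules `X, Y, Z` with a continuous equivariant pairing
`P : X × Y → Z`, and classes `x ∈ H¹(G/N, X^N)`, `y ∈ H¹(G/N, Y^N)`: if `H²(G/N, Z^N) = 0` then
`inf x ∪_P inf y = 0` in `H²(G, Z)`. Proof: `P` restricts to a pairing `P^N : X^N × Y^N → Z^N` of
`G/N`-modules (`⟨n x, n y⟩ = n⟨x, y⟩ = ⟨x, y⟩` on invariants); on representing crossed homomorphisms
`f`, `g` the cocycle `(inf f) ∪_P (inf g) : (σ, τ) ↦ ⟨f σ̄, g(σ̄τ̄) − g σ̄⟩` IS the inflation of the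
cocycle `f ∪_{P^N} g` (`ContPairing.cupCocycle_apply`, `contOneCocycles.pullback_apply`,
`contTwoCocycles.pullback_apply`), so `inf x ∪ inf y = inf (x ∪ y) = inf 0 = 0`
(`map_oneCocycleClass`, `map_twoCocycleClass`, `cupProduct_oneCocycleClass_eq_twoCocycleClass`).
[cite: NeukirchSchmidtWingberg2008, I §4 (1.4.2) and Prop. 1.5.3 (compatibility of ∪ with inf)] -/
theorem cupProduct_infOne_infOne_eq_zero
    (hZ : Subsingleton (continuousCohomology 2 (ρZ.quotientInvariants N).toTopRep))
    (x : continuousCohomology 1 (ρX.quotientInvariants N).toTopRep)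
    (y : continuousCohomology 1 (ρY.quotientInvariants N).toTopRep) :
    P.cupProduct (infOne N ρX x) (infOne N ρY y) = 0 := by
  -- the induced pairing `X^N × Y^N → Z^N` of `G ⧸ N`-modules
  let PN : ContPairing (ρX.quotientInvariants N).toTopRep (ρY.quotientInvariants N).toTopRep
      (ρZ.quotientInvariants N).toTopRep :=
    { toLin := LinearMap.mk₂ ℤ
        (fun (a : ρX.invariantsOf N) (b : ρY.invariantsOf N) ↦
          (⟨P.toLin (a : VX) (b : VY), fun n ↦ by
            have ha : ρX (n : G) (a : VX) = a := a.2 n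
            have hb : ρY (n : G) (b : VY) = b := b.2 n
            have h := P.toLin_smul (n : G) (a : VX) (b : VY)
            change P.toLin (ρX (n : G) (a : VX)) (ρY (n : G) (b : VY)) =
              ρZ (n : G) (P.toLin (a : VX) (b : VY)) at h
            rw [ha, hb] at h
            exact h.symm⟩ : ρZ.invariantsOf N))
        (fun a a' b ↦ Subtype.ext (by
          change P.toLin ((a : VX) + (a' : VX)) (b : VY) = P.toLin (a : VX) (b : VY) + P.toLin (a' : VX) (b : VY)
          rw [map_add, LinearMap.add_apply]))
        (fun c a b ↦ Subtype.ext (by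
          change P.toLin (c • (a : VX)) (b : VY) = c • P.toLin (a : VX) (b : VY)
          rw [map_zsmul, LinearMap.smul_apply]))
        (fun a b b' ↦ Subtype.ext (by
          change P.toLin (a : VX) ((b : VY) + (b' : VY)) = P.toLin (a : VX) (b : VY) + P.toLin (a : VX) (b' : VY)
          rw [map_add]))
        (fun c a b ↦ Subtype.ext (by
          change P.toLin (a : VX) (c • (b : VY)) = c • P.toLin (a : VX) (b : VY)
          rw [map_zsmul]))
      continuous_toLin := continuous_of_discreteTopology
      toLin_smul := by
        rintro ⟨g⟩ a b
        apply Subtype.ext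
        exact P.toLin_smul g (a : VX) (b : VY) }
  obtain ⟨f, rfl⟩ := oneCocycleClass_surjective _ x
  obtain ⟨g, rfl⟩ := oneCocycleClass_surjective _ y
  have hx : infOne N ρX (oneCocycleClass _ f) =
      oneCocycleClass _ (contOneCocycles.pullback (ContinuousMonoidHom.quotientMk N)
        (invariantsIncl N ρX) f) :=
    map_oneCocycleClass _ _ _ f
  have hy : infOne N ρY (oneCocycleClass _ g) =
      oneCocycleClass _ (contOneCocycles.pullback (ContinuousMonoidHom.quotientMk N)
        (invariantsIncl N ρY) g) :=
    map_oneCocycleClass _ _ _ g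
  rw [hx, hy, ContPairing.cupProduct_oneCocycleClass_eq_twoCocycleClass]
  have hcoc : P.cupCocycle
      (contOneCocycles.pullback (ContinuousMonoidHom.quotientMk N) (invariantsIncl N ρX) f)
      (contOneCocycles.pullback (ContinuousMonoidHom.quotientMk N) (invariantsIncl N ρY) g) =
      contTwoCocycles.pullback (ContinuousMonoidHom.quotientMk N) (invariantsIncl N ρZ)
        (PN.cupCocycle f g) := by
    refine Subtype.ext (ContinuousMap.ext fun q ↦ ?_)
    obtain ⟨σ, τ⟩ := q
    rw [ContPairing.cupCocycle_apply, contTwoCocycles.pullback_apply, ContPairing.cupCocycle_apply,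
      contOneCocycles.pullback_apply, contOneCocycles.pullback_apply, contOneCocycles.pullback_apply,
      map_mul]
    rfl
  rw [hcoc, ← map_twoCocycleClass, @Subsingleton.elim _ hZ (twoCocycleClass _ (PN.cupCocycle f g)) 0,
    map_zero]

end Abstract

/-! ## §2 At a non-archimedean local field: `H¹_ur ∪ H¹_ur = 0` -/

section LocalField

open Literature.NumberTheory.GaloisRepresentations.IsNonarchimedeanLocalField
open Summit.BirchSwinnertonDyer.Rank1Residual.Additive

variable {F : Type u} [Field F] [ValuativeRel F] [TopologicalSpace F] [IsNonarchimedeanLocalField F]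
-- Cup products need `LocallyCompactSpace Γ_F` (in the tree a LOCAL instance,
-- `absoluteGaloisGroup_compactSpace`); it is taken as an instance hypothesis of the statements.
variable [LocallyCompactSpace (Field.absoluteGaloisGroup F)]
variable {A B C : Type u}
  [AddCommGroup A] [TopologicalSpace A] [DiscreteTopology A]
  [AddCommGroup B] [TopologicalSpace B] [DiscreteTopology B]
  [AddCommGroup C] [TopologicalSpace C] [DiscreteTopology C]
  {ρA : DiscreteGaloisModule F A} {ρB : DiscreteGaloisModule F B} {ρC : DiscreteGaloisModule F C}

/-- **Unramified classes are isotropic for every cup product over a non-archimedean local field.**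
Let `F` be a non-archimedean local field, `A, B, C` discrete `Γ_F`-modules with `C` finite,
`P : A × B → C` a continuous equivariant pairing, and `a ∈ H¹_ur(F, A)`, `b ∈ H¹_ur(F, B)` unramified
classes (`DiscreteGaloisModule.unramifiedSubgroup · 1 = ker (H¹(F, ·) → H¹(F^nr, ·))`). Then
`a ∪_P b = 0` in `H²(F, C)`: both classes are inflated from `Γ_F/I_F`
(`Additive.mem_unramifiedSubgroup_one_iff_mem_range_infOne`, inflation–restriction, NO hypothesis on
the inertia action), their cup product is the inflation of a class of `H²(Γ_F/I_F, C^{I_F})`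
(`cupProduct_infOne_infOne_eq_zero`), and that group vanishes for finite `C` because
`Γ_F/I_F ≅ Ẑ` has cohomological dimension `1` (`subsingleton_two_quotient_galUnr_of_finite`). The
elementary half of Milne, *ADT*, I Prop. 2.6 (`H¹_ur(M) ⊥ H¹_ur(M^D)`), for an arbitrary pairing.
[cite: MilneADT2006, Ch. I §2, Prop. 2.6 and proof of Thm. 2.6]
[cite: SerreGaloisCohomology1997, II §5 (cd(Ẑ) = 1) and I §2.6 (b)] -/
theorem cupProduct_eq_zero_of_mem_unramifiedSubgroup [Finite C]
    (P : ContPairing ρA.toTopRep ρB.toTopRep ρC.toTopRep)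
    {a : galoisCohomology ρA 1} {b : galoisCohomology ρB 1}
    (ha : a ∈ DiscreteGaloisModule.unramifiedSubgroup ρA 1)
    (hb : b ∈ DiscreteGaloisModule.unramifiedSubgroup ρB 1) :
    P.cupProduct a b = 0 := by
  obtain ⟨x, rfl⟩ := (mem_unramifiedSubgroup_one_iff_mem_range_infOne ρA a).mp ha
  obtain ⟨y, rfl⟩ := (mem_unramifiedSubgroup_one_iff_mem_range_infOne ρB b).mp hb
  haveI : Finite (ρC.invariantsOf (galUnr F)) := Subtype.finite
  haveI : CompactSpace (Field.absoluteGaloisGroup F) := absoluteGaloisGroup_compactSpace F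
  exact cupProduct_infOne_infOne_eq_zero (galUnr F) P
    (subsingleton_two_quotient_galUnr_of_finite F (ρC.invariantsOf (galUnr F))
      (ρC.quotientInvariants (galUnr F))) x y

end LocalField

/-! ## §3 Restricted pairings: modules over a field `K`, classes over a `K`-field `F` which is a local field -/

section Restricted

open Literature.NumberTheory.GaloisRepresentations.IsNonarchimedeanLocalField

variable {K : Type u} [Field K] (F : Type u) [Field F] [Algebra K F] [ValuativeRel F] [TopologicalSpace F]
  [IsNonarchimedeanLocalField F] [LocallyCompactSpace (Field.absoluteGaloisGroup F)]
variable {A B C : Type u}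
  [AddCommGroup A] [TopologicalSpace A] [DiscreteTopology A]
  [AddCommGroup B] [TopologicalSpace B] [DiscreteTopology B]
  [AddCommGroup C] [TopologicalSpace C] [DiscreteTopology C]
  {ρA : DiscreteGaloisModule K A} {ρB : DiscreteGaloisModule K B} {ρC : DiscreteGaloisModule K C}

/-- **Unramified classes are isotropic — restricted form.** For discrete `Γ_K`-modules `A, B, C`
over a field `K` (`C` finite) with a continuous equivariant pairing `P : A × B → C`, and a `K`-field
`F` which is a non-archimedean local field (a completion `K_v`): unramified classes
`a ∈ H¹_ur(F, A|_{Γ_F})`, `b ∈ H¹_ur(F, B|_{Γ_F})` have `a ∪ b = 0` for the restricted pairing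
`P.restrict (absGaloisRestrict K F)` — the shape of the local Weil cup product
`H¹(K_v, E[n]) × H¹(K_v, E[n]) → H²(K_v, μₙ)` of `LocalWeilPairingDuality.lean`
(`(weilContPairing W n e …).restrict (absGaloisRestrict K K_v)`).
[cite: MilneADT2006, Ch. I §2, Prop. 2.6 and proof of Thm. 2.6] -/
theorem cupProduct_restrict_eq_zero_of_mem_unramifiedSubgroup [Finite C]
    (P : ContPairing ρA.toTopRep ρB.toTopRep ρC.toTopRep)
    {a : galoisCohomology (GaloisRep.restrictField F ρA) 1}
    {b : galoisCohomology (GaloisRep.restrictField F ρB) 1}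
    (ha : a ∈ DiscreteGaloisModule.unramifiedSubgroup (GaloisRep.restrictField F ρA) 1)
    (hb : b ∈ DiscreteGaloisModule.unramifiedSubgroup (GaloisRep.restrictField F ρB) 1) :
    (P.restrict (absGaloisRestrict K F)).cupProduct a b = 0 :=
  cupProduct_eq_zero_of_mem_unramifiedSubgroup (ρA := GaloisRep.restrictField F ρA)
    (ρB := GaloisRep.restrictField F ρB) (ρC := GaloisRep.restrictField F ρC)
    (P.restrict (absGaloisRestrict K F)) ha hb

end Restricted

end TwoLagrangianLines

end Summit.BirchSwinnertonDyer.Rank1Residual.GaloisImage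

end
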